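import Mathlib
import HarnessLib
import HarnessLib.Audit
import Summits.AtomisticToContinuum.Statement

/-!
Route: PlanarWeakBV

CLOSED (retired) 2026-08-15T13:45:38Z by operator:999:1257524 — reason: not-a-thesis: assembly does not conclude the sub-problem Statement — note: D-0027 §2.1 audit (human 2026-08-15: routes that do not decide the summit are removed): the assembly concludes `PlanarShockLimit`, not the sub-problem statement; a NEW conforming route may be opened from the same idea (generated `closes : … → _root_.HydrodynamicLimit`).. The file is kept as the record of this route; refuted decls are indexed as negative knowledge (`ledger negatives`).

# Route PlanarWeakBV — planar symmetry pins deterministic limits to 1-D and weak-BV (a-contraction)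
uniqueness closes through the shock, up to the first shock–shock collision

It suffices to show X = PlanarDeterminism ∧ PlanarMesoscaleRegularity ∧ PlanarEntropicClosure ∧
PlanarTraceRegularity ∧ WeakBVUniquenessHS ∧ PlanarLawInvariance, where the first four are
MICROSCOPIC statements about the deterministic 3-D hard-sphere gas at fixed reduced density started
from PLANAR local Gibbs laws (profiles depending on x₁ only, velocity along e₁) — the macrostate
stays deterministic at all times, mesoscale slab profiles are self-averaging and L¹-equicontinuous,
and strong subsequential limits are bounded weak entropy solutions of the 1-D hard-sphere Euler
system, with strong traces — the fifth is the PDE closer (weak–BV uniqueness of small-BV entropy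
solutions for the hard-sphere law, Chen–Vasseur a-contraction) and the sixth the symmetry lemma. X
implies the route's target PlanarShockLimit: convergence in probability of the empirical fields to
the planar lift of the small-BV entropy solution at EVERY t of any window [0,T) on which that
solution exists, has small variation and is CONTACT-FREE — through shock formation, propagation and
shock–rarefaction interaction, i.e. across the ShockFormation barrier in the planar class (card
planar-post-shock-weak-bv-uniqueness, spine; target = the card's thesis cut back to contact-free
windows, see Why this line / Kill criteria). It reproduces the conjunct for planar small-variation
data before T* and says nothing about non-planar profiles (the assembly ends in the route's target,
not in the conjunct).
Lean: `PlanarDeterminism ∧ PlanarMesoscaleRegularity ∧ PlanarEntropicClosure ∧ PlanarTraceRegularity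
∧ WeakBVUniquenessHS ∧ PlanarLawInvariance`

## Assembly
Soft analysis, no microscopic input beyond the items (difficulty L as a Lean proof): fix η₀ :=
min(η₀ of PlanarEntropicClosure, η₀ of WeakBVUniquenessHS / 2), the profiles, σ₀ := the minimum over
the cruxes, σ, the box (m,M), ε₀ := min(ε₀ of the closure crux at (η₀,m,M), ε₀ of the uniqueness
crux at the widened box (m/2, 2M)); take T, a contact-free small-BV reference, a flow family and the
t = 0 LLN, and suppose convergence fails at some t < T for some χ, δ along a subsequence.
PlanarMesoscaleRegularity (b) + L¹-boundedness make the expected slab profiles precompact in L¹(𝕋¹)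
uniformly in t ≤ T; PlanarDeterminism (b) gives weak equicontinuity in time, which on a norm-compact
set is strong equicontinuity, so Fréchet–Kolmogorov + a diagonal argument extract a further
subsequence along which expected slab profiles converge in L¹((0,T)×𝕋¹), and
PlanarMesoscaleRegularity (a) upgrades this to convergence in probability of the slab fields
themselves; PlanarLawInvariance (reflections) kills the transverse momentum of the limit.
PlanarEntropicClosure turns the limit into a weak entropy solution in the widened box with the
reference's initial slice, PlanarTraceRegularity supplies its strong traces; WeakBVUniquenessHS
(invoked at the widened box) identifies it with the reference a.e. on [0,T). Uniqueness of
subsequential limits gives convergence of slab fields along the whole sequence; PlanarDeterminism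
(a)+(b) with PlanarLawInvariance (translations: limit measures of χ-tested fields are invariant
under transverse shifts, hence products of Haar measure on 𝕋² with the 1-D limit) and the
time-continuity of the reference convert L¹-in-time convergence of planar tests into convergence at
every t for every continuous χ on 𝕋³ — contradiction.

Rationale: WHY THIS LINE. Two remarks remove the two PDE obstructions that stop the conjunct at the first
shock, in the planar class: (S) the local Gibbs law and the dynamics are invariant under transverse
translations, so a DETERMINISTIC limit of the fields is x₂,x₃-independent and every
multi-dimensional wild solution (ChiodaroliDeLellisKreml2015, Markfelder2021 Thm 8.3.1: non-planar
fans on planar Riemann data) is excluded at zero cost; (U) in one dimension weak–BV uniqueness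
replaces weak–strong uniqueness — a small-BV entropy solution is unique and L²-stable among bounded
weak solutions with ONE entropy inequality and strong traces (ChenKrupaVasseur2022 Thm 1.3 for 2×2,
ChenVasseur2024 for the nonisentropic Euler system; KangVasseur2020, KangVasseurWang2021 and
ChenKangVasseur2024/Vasseur2026 for the inviscid-limit versions), exactly the regularity a particle
limit can hope for. Imported area: hyperbolic conservation laws — a-contraction with shifts, front
tracking, Glimm's small-BV theory (QuXin2014 on the torus), Vasseur's strong traces; the microscopic
side keeps the architecture of route DissipativeWeakStrong (flux closure + free second law) but must
deliver STRONG compactness and determinism instead of measure-valued limits, stated here as four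
typed cruxes over the conjunct's vocabulary (slab fields, laws, flows; each item is a one-line Prop
with a `let` prelude naming the weak-solution, box, variation, contact and trace predicates). New
relative to the card and its audit (and the reason the target is cut back): a contact discontinuity
born at a shock–shock collision has width (Kn·t)^1/2 = N^-1/6 t^1/2 in the gas and, whenever a
passing wave accelerates it against its density jump, is Rayleigh–Taylor unstable at rate (gA/w)^1/2
≍ ε²N^1/12 → ∞, so thermal seeds N^-1/4 saturate in vanishing time and a mixing zone of
N-INDEPENDENT width ≍ αAgt² = O(ε⁴) forms (the baroclinic twin of the Kelvin–Helmholtz arithmetic of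
card zero-horizon-statistical-solutions, which certified the planar class safe because its contacts
carry no shear; BandakEtAl2024 and KadauEtAl2004 for thermal-noise seeding) — hence past the first
collision the transversally averaged limit should miss the exact entropy solution by O(ε⁷) in L¹
(invisible below N ~ 10³⁰, fatal for an exact theorem), while shocks (Majda-stable,
doi:10.1090/memo/0275) and smooth entropy gradients (bounded rates) are safe: the target is
therefore stated on contact-free windows, which is where the card's mechanism is believed exact. No
prior route or negative (index empty) reaches past T*.

RANKED CRUXES. #0 PlanarShockLimit (target) — THROUGH THE SHOCK IN THE PLANAR CLASS, UP TO THE FIRST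
CONTACT. ∃ η₀ > 0 ∀ continuous planar profiles (activity A, temperature Θ > 0, velocity U·e₁,
functions of x₁ ∈ 𝕋¹) ∃ σ₀ > 0 ∀ σ ∈ (0,σ₀) ∀ box 0 < m ≤ · ≤ M ∃ ε₀ > 0 ∀ T ∀ REFERENCE (ρ,u,θ) on
[0,T) × 𝕋¹ that is (S) a bounded measurable weak solution of 1-D hard-sphere Euler (p = ρθZ(ρσ³), E
= ρ(u²/2 + 3θ/2)) with the physical entropy inequality ∂ₜ(−ρs) + ∂ₓ(−ρsu) ≤ 0, s = 3/2 log θ − log ρ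
− f_ex(ρσ³), initial term its own t = 0 slice, continuous in time into L¹; (B) valued in the box
with packing ρσ³ ≤ η₀; (Vr) of variation ≤ ε₀ per period at every t (shocks allowed); (C)
CONTACT-FREE: at every t, wherever u is continuous so is ρ — and ∀ flow families: LLN of the 3-D
empirical density/momentum/energy fields at t = 0 towards the planar lift of (ρ, ρu e₁, E)(0) ⟹ LLN
towards the lift of (ρ, ρu e₁, E)(t) at EVERY t < T. T is any time of contact-free small-BV
existence: shock formation, propagation, decay, shock–rarefaction interaction included (the card's
thesis cut back from all t to contact-free windows, see Kill criteria); for t < T* it is the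
conjunct on planar small-variation data. (why it might fail: Vacuous if no contact-free small-BV
window went past T* (it does: single-hump simple-wave data, one shock per period, no collision);
fails if some planar structure other than contacts sharpens with N and seeds mesoscale mixing, or if
any of the five cruxes fails.) [Spohn1991, ChenVasseur2024, KangVasseurWang2021, Markfelder2021,
ChenKrupaVasseur2022]
#2 PlanarEntropicClosure (crux) — ENTROPIC CLOSURE OF STRONG SUBSEQUENTIAL LIMITS (card crux 2 + the
audit's no-vacuum flag). Quantifiers as in the target (with the packing threshold η ≤ η₀ uniform);
for every contact-free small-BV reference matched to the data by the t = 0 LLN, every flow family,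
every mesoscale ℓ_N → 0 with Nℓ_N → ∞ and every subsequence κ: IF the transversally averaged slab
fields (density, momentum, energy over slabs {x₁ ∈ [r, r+ℓ_N)}) converge along κ in probability in
L¹((0,T) × 𝕋¹) to some deterministic triple, THEN the limit is (the conserved triple of) a weak
entropy solution (ρ′,u′,θ′) of planar hs-Euler on [0,T) × 𝕋¹ in the sense (S) of the target, valued
in the widened box (m/2, 2M) with packing ≤ 2η, whose t = 0 slice is the reference's a.e.
Microscopic content: local equilibrium of slab fluxes off a set of vanishing measure (shock layers
of width O(Kn) carry no macroscopic defect), the free second law, L∞/no-vacuum bounds; strong traces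
are the separate crux PlanarTraceRegularity. [deps: PlanarMesoscaleRegularity, PlanarDeterminism]
[difficulty: open-problem] (why it might fail: Needs L∞/no-vacuum bounds and local equilibrium of
slab fluxes off the O(Kn) shock layers with no entropy pin after T* (BoltzmannHypothesis barrier in
flux form); the collisional-flux and velocity-tail estimates uniform through compressions that this
requires may simply not exist.) [Spohn1991, OllaVaradhanYau1993, doi:10.1007/s002050100157,
ChenKrupaVasseur2022, FritzToth2004, Fritz2011]
#3 PlanarMesoscaleRegularity (crux) — NO MESOSCALE RANDOMNESS, NO MESOSCALE OSCILLATION ('particle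
compensated compactness', card crux 1). For continuous planar profiles, σ < σ₀, every flow family
and every mesoscale ℓ_N → 0 with Nℓ_N → ∞: (a) at every t ≥ 0 the slab fields are L¹(𝕋¹)-close in
probability to their expectations; (b) for every horizon and ε′ there are h₀, N₀ such that for N ≥
N₀ and all t ≤ horizon the EXPECTED slab profiles move by ≤ ε′ in L¹ under spatial shifts |h| ≤ h₀
(Kolmogorov–Riesz; shocks allowed, persistent sub-grid oscillation not). All times, no window: slabs
are exact transverse averages, expected to survive even collision-born mixing zones. [difficulty:
XL] (why it might fail: No known mechanism for 'particle compensated compactness': after T* nothing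
books mesoscale order (pre-shock large deviations do); persistent N-independent mesoscale structure
(acoustic ringing, or RT debris at collision-born contacts) would break L1-equicontinuity of the
expected slab profiles.) [FritzToth2004, Fritz2011, DiPernaMajda1987,
doi:10.4007/annals.2005.161.223, Dafermos2005, Spohn1991]
#4 PlanarDeterminism (crux) — DETERMINISM OF THE MACROSTATE AT ALL TIMES (the audit's unlisted crux
'PlanarityPersistence', typed over the conjunct's vocabulary). For continuous planar profiles, σ <
σ₀, every flow family and every continuous χ on 𝕋³ there are deterministic centre paths c_N(t) ∈ ℝ ×
ℝ³ × ℝ with (a) at EVERY t ≥ 0 the χ-tested empirical density/momentum/energy fields concentrate in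
probability around c_N(t) (LLN without identification, through shocks and collisions), (b) {c_N}
equicontinuous on bounded time intervals uniformly in N (where collisional momentum/energy transfer
must be tight). With PlanarLawInvariance it pins limit points to planar fields — the card's symmetry
remark (S) that removes multi-d wild solutions for deterministic limits. [difficulty: XL] (why it
might fail: Macroscopic randomness may appear after T*: thermal seeds N^-1/2 amplified at an
N-divergent rate (KH at slip surfaces: N^1/6, zero-horizon card); planar hs-shocks are Majda-stable
and planar contacts carry no shear, but RT at accelerated contacts (rate eps^2 N^1/12) is only
argued to self-average.) [doi:10.1090/memo/0275, Majda1984, BandakEtAl2024, KadauEtAl2004,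
Spohn1991, OllaVaradhanYau1993]
#5 PlanarTraceRegularity (crux) — STRONG TRACES OF STRONG LIMITS (audit flag (2) as its own crux:
the regularity half of the weak–BV competitor class). For continuous planar profiles, σ < σ₀, every
box (η,m,M), horizon T, flow family, ℓ_N, κ: a triple (ρ′,u′,θ′) whose conserved fields are the
L¹((0,T)×𝕋¹)-in-probability limit of the slab fields along κ and which is a weak entropy solution
(S) valued in the box has strong traces in Vasseur's ess-lim L¹ form along every Lipschitz curve,
from both sides, on every [0,T′], T′ < T. No window restriction: a limit that is BV in x at a.e. t
has them; the content is that particle limits are at least that regular. [deps: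
PlanarEntropicClosure] [difficulty: open-problem] (why it might fail: Strong traces are theorems for
scalar laws (Vasseur 2001, kinetic formulation) and automatic for BV functions; for L∞ entropy
solutions of systems they are open (CKV 2022: mostly open) and a particle limit need not be BV; even
the ess-lim form may fail where wave interactions accumulate.) [doi:10.1007/s002050100157,
ChenKrupaVasseur2022, LegerVasseur2011, doi:10.1142/s0219891619500061, Dafermos2005]
#6 WeakBVUniquenessHS (crux) — WEAK–BV UNIQUENESS FOR THE HARD-SPHERE LAW ON THE 1-TORUS (card crux
3; PDE). ∃ η₀ > 0 ∀ σ > 0 ∀ box (m,M) ∃ ε₀ > 0: on any [0,T) × 𝕋¹ a weak entropy solution (S) valued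
in the box with packing ≤ η₀ and variation ≤ ε₀ per period at every t is UNIQUE among weak entropy
solutions (S) in the same box having ess-lim strong traces and the same t = 0 slice a.e.
ChenVasseur2024 (nonisentropic ideal gas: small-BV solutions unique among a large family of weak
solutions; weighted relative entropy with shifts + modified front tracking, CKV2022 Thm 1.3
architecture) adapted to p = ρθZ(ρσ³), e = 3θ/2 (strict hyperbolicity, genuinely nonlinear acoustic
fields, strictly convex −ρs at packing < η₀: HsEulerGNL, HsEntropyConvex), localised to the torus by
finite propagation speed. [deps: HsEulerGNL, HsEntropyConvex] [difficulty: L] (why it might fail: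
ChenVasseur2024 is printed for the ideal gas on R with the CKV competitor class (L∞, one entropy,
sup-form traces); for p = rho theta Z(rho sigma^3) the shock a-contraction criteria must be
re-verified (GNL and entropy convexity hold at small packing); ess-lim traces and the torus are
adaptations.) [ChenVasseur2024, ChenKrupaVasseur2022, KangVasseur2020, Vasseur2026,
doi:10.1142/s0219891619500061, LegerVasseur2011, BressanGuerra2024]
#9 PlanarLawInvariance (support) — SYMMETRY OF THE LAW (card support (S)). For every σ, N, flow Φ,
time t: profiles invariant under a translation of 𝕋³ ⟹ the time-t law (push-forward of the local
Gibbs law by Φ_t) is invariant under translating all positions; profiles invariant under reflection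
of the j-th coordinate (velocity reflected) ⟹ the time-t law is invariant under reflecting the j-th
position and velocity coordinates of all particles. Planar profiles: all transverse translations and
both transverse reflections (expected transverse momenta vanish, expected fields are
x₂,x₃-independent). Proof: isometry invariance of canonicalDensity/hardSphereDomain, a.e. uniqueness
of trajectories (IsHardSphereTrajectory.unique), Liouville. [difficulty: provable-now] [Spohn1991,
Alexander1975]
#9 HsEulerGNL (support) — STRUCTURE OF PLANAR hs-EULER AT LOW PACKING (audit flag (4)). ∃ η₀ > 0: Z
= hsCompressibility is C² on [0,η₀] and for η ≤ η₀: Φ := Z + ηZ′ + (2/3)Z² > 0 (strict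
hyperbolicity, c² = θΦ) and Ψ := (2 + (2/3)Z)Φ + ηΦ′ > 0 (genuine nonlinearity of both acoustic
fields: ∂²p/∂τ²|ₛ = θτ⁻³Ψ for p = θZ(σ³/τ)/τ, e = 3θ/2). At η = 0: Φ = 5/3, Ψ = 40/9 = γ(γ+1), γ =
5/3 (norm_num in the planner's Check.lean); C² of Z near 0 is the virial analyticity
(HsEosLowDensity, stmt 0768). [difficulty: M] [Ruelle1969, LebowitzPenrose1964, Dafermos2005]
#9 HsEntropyConvex (support) — THERMODYNAMIC STABILITY (shared: identical to
stmt-AtomisticToContinuum-0817 of route DissipativeWeakStrong, re-wanted as the single strictly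
convex entropy of the a-contraction theory): strict convexity of U = (ρ,m,E) ↦ −ρ(3/2 log θ(U) − log
ρ − f_ex(ρσ³)) on {ρ > 0, ρσ³ < η₀, |m|² < 2ρE}. [difficulty: M] [Dafermos2005, BrezinaFeireisl2018,
Ruelle1969]
#9 SmallBVExistenceT1 (support) — NON-VACUITY OF THE TARGET'S REFERENCE: ∃ η₀ > 0 ∀ σ > 0, box, ε₀ >
0, T ∃ ε₁ > 0: every measurable datum on 𝕋¹ of variation ≤ ε₁ in the half-box (2m ≤ ρ₀,θ₀ ≤ M/2,
|u₀| ≤ M/2, packing ≤ η₀/2) launches a weak entropy solution (S) on [0,T) × 𝕋¹ with that initial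
slice, in the box, of variation ≤ ε₀ at every t < T. Glimm/front tracking on ℝ + finite propagation
speed for periodic data (per-period variation ≲ ε₀/(1+T)); QuXin2014: long-time periodic existence
for the nonisentropic ideal gas. Contact-freeness is not asserted (it holds before the first
shock–shock collision, e.g. for single-hump simple-wave data on all of [0,T)). [deps: HsEulerGNL,
HsEntropyConvex] [difficulty: XL] [doi:10.1002/cpa.3160180408, Bressan2024, QuXin2014, Dafermos2005,
LiuYang1999]

TWO-LAYER PLAN. Foreseen glued splits (nothing filed now; k ≤ 3, depth 1): PlanarEntropicClosure ⇐
SlabFluxClosure (slab momentum/energy fluxes = hs-Euler fluxes of the slab fields + o(1) in L¹ off a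
set of vanishing measure) → EntropyAndBounds (free second law in 𝒟′, L∞/no-vacuum box, initial
slice) → PlanarEntropicClosure. PlanarTraceRegularity ⇐ LimitIsBVae (the strong limit has bounded
variation in x at a.e. t — a 'microscopic Glimm functional' would give it) → TracesOfBV →
PlanarTraceRegularity. PlanarMesoscaleRegularity ⇐ SlabSelfAveraging (variance of slab fields → 0 at
every t) → ExpectedProfileEquicontinuity → PlanarMesoscaleRegularity. WeakBVUniquenessHS ⇐
HsShockContraction (Kang–Vasseur a-contraction criteria for hs 1- and 3-shocks at packing < η₀) →
TorusFrontTracking (CKV weighted front tracking with ess-lim traces, localised by finite speed) →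
WeakBVUniquenessHS. PlanarDeterminism ⇐ CollisionFluxTightness (expected collisional momentum/energy
transfer per unit time O(1)) → VarianceDecay → PlanarDeterminism.

KILL CRITERIA. (i) ¬PlanarDeterminism for one planar profile and one time (liminf_N Var > 0) closes
the route `refuted:PlanarDeterminism` and is itself a theorem worth having (spontaneous
stochasticity in planar geometry); (ii) ¬PlanarEntropicClosure or ¬PlanarMesoscaleRegularity inside
a contact-free window (e.g. a persistent flux defect at a single decaying shock) closes the route
and with it every field-level post-shock programme for hard spheres; (iii) if WeakBVUniquenessHS
fails for the hs law (an a-contraction shock criterion violated at small packing) pivot the closer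
to BV-uniqueness without tame oscillation (BressanGuerra2024 / Bressan–De Lellis 2023) at the price
of a new crux 'the particle limit has small BV', or to a-contraction performed at the particle level
(weighted relative entropy with shifts against the front-tracking pattern — a different mechanism,
new card); (iv) the card's UNRESTRICTED thesis (all t, through shock–shock collisions) is
conjectured false here by the Rayleigh–Taylor arithmetic of Why this line; a refuter who makes that
rigorous in any caricature (fluctuating 1-D–2-D lattice gas, stochastic p-system with an entropy
field) kills every exact post-collision planar thesis, and conversely a proof that hs contacts stay
RT-stable in the limit lets tenure restate the target without ContactFree (`--restate
PlanarShockLimit`); (v) HydrodynamicLimit refuted in the smooth regime (negatives index) moots the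
route.

NOT DECOMPOSED YET. The glue lemmas of the assembly (Fréchet–Kolmogorov extraction in (t,r), Haar
characterisation of transversally invariant limit measures, the every-t upgrade, restriction of
references to sub-windows); the collision-flux bound inside PlanarDeterminism (b); the mesoscale
statics LLN (not needed: equicontinuity + the macroscopic LLN at t = 0 identify the initial slice);
the Majda/uniform-Lopatinski and D'yakov–Kontorovich computations for hs shocks (heuristic
guarantors of determinism, audit flag (5)); definitions that would shorten the four long signatures
(see Definition requests); the whole post-collision regime (what IS the limit past the first
contact? an 'Euler + RT mixing zone' object — deliberately outside this route); the ε-window corner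
(card burgers-window-through-the-shock) where cruxes 2–3 should be proved first.

CHEAPEST FALSIFIER. Symbolic first (an afternoon; refuters run it): with Z(η) = 1 + (2π/3)η + B₃η² +
… check on [0, η₀] the three structural inputs of WeakBVUniquenessHS — Φ = Z + ηZ′ + 2Z²/3 > 0, Ψ =
(2 + 2Z/3)Φ + ηΦ′ > 0 (at η = 0: 5/3 and 40/9, done in the planner's Check.lean), strict convexity
of −ρs (HsEntropyConvex) — and the Kang–Vasseur a-contraction criterion for weak 1- /3-shocks of this
law; any failure at small packing kills crux 5 as stated. Then MD (decisive for cruxes 2–4, cheap):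
event-driven hard spheres at φ = 0.05 in a thin periodic cross-section, N = 10⁵–10⁷, planar
3-simple-wave data u¹ = δ sin 2πx₁ of finite amplitude: ensemble variance of χ-tested fields (crux
4) and L¹ distance of slab profiles to a 1-D Godunov/Glimm solution (cruxes 2–3) through formation
and decay of the single shock per period must decay like powers of N with NO plateau after T*; a
plateau or growing variance kills the line. (The post-collision RT deviation predicted in Why this
line is O(ε⁷) and needs N ≳ 10³⁰: MD cannot see it — only theory separates the restricted from the
unrestricted thesis.)

NUMBERS. Kn = mean free path ≍ N^-1/3/σ² (macroscopic units), shock width O(Kn), ≍ N^1/3 collisions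
per particle per unit time; contact width (Kn t)^1/2 = N^-1/6 t^1/2, thermal seed at that scale (N
w³)^-1/2 = N^-1/4; KH growth at a slip surface ∫γ ≍ ΔU N^1/6 t^1/2 (zero-horizon card) versus RT
growth at an accelerated contact ∫γ ≍ (gA)^1/2 Kn^-1/4 t^3/4 ≍ ε²N^1/12 (A ≍ ε³ entropy jump of a
collision-born contact, g ≍ ε), nonlinear mixing width h ≍ αAgt² ≈ 0.05 ε⁴, L¹ density defect ≍ Ah ≍
0.05 ε⁷; ideal-gas limits c² → 5θ/3, Ψ(0) = γ(γ+1) = 40/9; weak–BV class = L∞ + one convex entropy +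
strong traces (ChenKrupaVasseur2022 Def 1.2, Thm 1.3); items at open: 11 (1 target, 5 cruxes, 4
support, 1 assembly).

DEFINITION REQUESTS. To be filed right after open (they would replace the `let` preludes
S/B/Vr/C/Q/D/ST that every long item now carries; tenure restates when they land):
`HsEulerPlanarEntropySolution σ T ρ u θ` (topic Literature/Analysis/FluidPDE: the predicate S used
in five items — measurable bounded fields on [0,T) × 𝕋¹, three conservation laws and the −ρs
inequality in 𝒟′ with initial term, C([0,T); L¹)); `HasStrongTraces T ρ u θ`
(Literature/Analysis/FluidPDE: Vasseur's ess-lim L¹ traces along Lipschitz curves, both sides);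
`slabFields` (Summits/AtomisticToContinuum/HydrodynamicLimit/Theorems: transversally averaged
mesoscopic slab density/momentum/energy of a configuration). Cite facts wanted: ChenVasseur2024 main
theorem (acq-02251 pending: paywalled), QuXin2014 main theorem (acq-02344), Majda 1983 uniform
stability of gas-dynamic shocks.

Novelty: Searches (2026-08-15): `lit search --source crossref "weak-BV uniqueness nonisentropic Euler Chen
Vasseur"` (10 rows: doi:10.4208/cmaa.2024-0019, doi:10.5802/jedp.701,
doi:10.1007/s00205-022-01813-0); `lit read doi:10.5802/jedp.701` (Vasseur2026 survey, pp. 2–8,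
12–14: Thm 1–2 inviscid-limit weak/BV stability 'requires neither strong trace assumptions nor a
priori L∞ bounds'; refs [15],[16],[31],[32]); `lit read arxiv:2010.04761` (CKV: S_weak, Def 1.2
strong traces, Thm 1.3/1.4); `lit read doi:10.4208/cmaa.2024-0019` → paywalled, abstract only
(acq-02251); `lit search --source crossref "Qu Xin long time existence ... periodic"`
(doi:10.1007/s00205-014-0807-0, paywalled, acq-02344); `lit search --source crossref` ×3 on
thermal-noise-seeded Rayleigh–Taylor / spontaneous stochasticity (doi:10.1073/pnas.0401228101,
doi:10.1103/physrevlett.132.104002, doi:10.1103/physreve.105.065113); `lit frontier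
AtomisticToContinuum --since 2020` (30 rows, none on a-contraction, weak-BV or planar post-shock
particle limits); `lit bridges AtomisticToContinuum --cross any` (none relevant); `lit galaxy search
"weak-BV uniqueness for nonisentropic Euler" --star all` (0 hits) and `--star pdf "weak-BV"`
(service saturated, rc 1); local `lit search --hybrid` daemon down (connection reset) at 11:15Z; all
135 cards of the sub grep'd for Rayleigh/contact/Richtmyer (8 files; only
zero-horizon-statistical-solutions treats instability of thin layers, for shear); 7 route files of
the sub read (none past T*);  [refs: 10.4208/cmaa.2024-0019, 10.5802/jedp.701, 10.1007/s00205-022-01813-0, 10.5802/jedp.701`, 10.4208/cmaa.2024-0019`, 10.1007/s00205-014-0807-0, 10.1073/pnas.0401228101, 10.1103/physrevlett.132.104002, 10.1103/physreve.105.065113, 2010.04761, doi:10.4208/cmaa.2024-0019, doi:10.5802/jedp.701, doi:10.1007/s00205-022-01813-0, arxiv:2010.04761, doi:10.1007/s00205-014-0807-0, doi:10.1073/pnas.0401228101, d]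

Barriers (technique_class: weak-BV-uniqueness a-contraction symmetry-reduction): - technique_class: weak-BV-uniqueness a-contraction symmetry-reduction
- Literature.Barriers.AtomisticToContinuum.ShockFormationBarrier: crossed in the planar class — no
smooth reference is used after T*; the reference is the small-BV entropy solution and the stability
theory is a-contraction with shifts, built for discontinuous references (the Narrow entry records
that the printed restriction is for the unshifted-reference family only); outside symmetry-reduced
classes the barrier stands.
- Literature.Barriers.AtomisticToContinuum.WildSolutionsBarrier: evaded — wild admissible solutions
on planar data are non-planar (Markfelder2021 Thm 8.3.4: only the velocity is wild, via 2-D fans),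
hence not in-probability DETERMINISTIC limits of an x₂,x₃-invariant law (PlanarDeterminism +
PlanarLawInvariance); among planar bounded entropy solutions with traces uniqueness holds
(WeakBVUniquenessHS); the Narrow entry already notes that a-contraction against one planar target
never uses uniqueness in the L∞ admissible class. Honest residue: if PlanarDeterminism fails, (S) is
void.
- Literature.Barriers.AtomisticToContinuum.NoBVEstimatesMultiDBarrier: evaded — after (S) the
macroscopic problem is one-dimensional (Rauch's Example 1, evasion (ii)); no multi-d BV estimate and
no BV estimate on particle fields is claimed (only the reference is BV; the competitor class is L∞ +
traces).
- Literature.Barriers.AtomisticToContinuum.NonAttractiveSystemsBarrier: not met — no coupling/order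
preservation

Novelty grade: new-combination — route-review (refuter rreview-c9821b09), recorded for the SUCCESSOR route (this one was retired 13:45Z under D-0027 §2.1 because the assembly ends in PlanarShockLimit, not the sub-problem Statement): novelty as claimed (weak-BV a-contraction uniqueness as the closer of a PARTICLE limit past shocks + (refuter refuter-rreview-route-AtomisticToContinu-c9821b09-0, 2026-08-15T14:01:02Z; prior: ChenVasseur2024 doi:10.4208/cmaa.2024-0019; ChenKrupaVasseur2022 arXiv:2010.04761 Thm 1.3 (weak-BV uniqueness, a-contraction), FritzToth2004 / Fritz2011 (stochastic two-conservation-law systems past shocks, compensated compactness), Markfelder2021 Thm 8.3.1/8.3.4; ChiodaroliDeLellisKreml2015 (non-planar wild solutions on planar data))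

History (route lifecycle, newest last):
- 2026-08-15T13:45:38Z · CLOSED retired — not-a-thesis: assembly does not conclude the sub-problem Statement (operator:999:1257524)

sub-problem: HydrodynamicLimit · status: closed(retired) · opened planner-plancard-AtomisticToContinuum-Hydrody-a9f5d164-0 2026-08-15T12:16:44Z · rev 0 · ledger route-AtomisticToContinuum-PlanarWeakBV
GENERATED by the gate from the ledger (D-0016/17). Provers cite these decls: `theorem foo : Summit.AtomisticToContinuum.HydrodynamicLimit.Theses.PlanarWeakBV.<Decl> := …` in Summits/AtomisticToContinuum/HydrodynamicLimit/Theorems/<Name>.lean.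
-/

namespace Summit.AtomisticToContinuum.HydrodynamicLimit.Theses.PlanarWeakBV

open scoped BigOperators Topology Manifold Classical MeasureTheory ProbabilityTheory Matrix InnerProductSpace ComplexConjugate ContinuousMap
open Filter Set Function TopologicalSpace MeasureTheory

attribute [summit_statement] _root_.HydrodynamicLimit

/-- item stmt-AtomisticToContinuum-7704 · target · rank 0 · closed · moot by None · by planner
why it might fail: Vacuous if no contact-free small-BV window went past T* (it does: single-hump simple-wave data, one shock per period, no collision); fails if some planar structure other than contacts sharpens with N and seeds mesoscale mixing, or if any of the five cruxes fails.
sources: Spohn1991, ChenVasseur2024, KangVasseurWang2021, Markfelder2021, ChenKrupaVasseur2022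
[target] THROUGH THE SHOCK IN THE PLANAR CLASS, UP TO THE FIRST CONTACT. ∃ η₀ > 0 ∀ continuous
planar profiles (activity A, temperature Θ > 0, velocity U·e₁, functions of x₁ ∈ 𝕋¹) ∃ σ₀ > 0 ∀ σ ∈
(0,σ₀) ∀ box 0 < m ≤ · ≤ M ∃ ε₀ > 0 ∀ T ∀ REFERENCE (ρ,u,θ) on [0,T) × 𝕋¹ that is (S) a bounded
measurable weak solution of 1-D hard-sphere Euler (p = ρθZ(ρσ³), E = ρ(u²/2 + 3θ/2)) with the
physical entropy inequality ∂ₜ(−ρs) + ∂ₓ(−ρsu) ≤ 0, s = 3/2 log θ − log ρ − f_ex(ρσ³), initial term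
its own t = 0 slice, continuous in time into L¹; (B) valued in the box with packing ρσ³ ≤ η₀; (Vr)
of variation ≤ ε₀ per period at every t (shocks allowed); (C) CONTACT-FREE: at every t, wherever u
is continuous so is ρ — and ∀ flow families: LLN of the 3-D empirical density/momentum/energy fields
at t = 0 towards the planar lift of (ρ, ρu e₁, E)(0) ⟹ LLN towards the lift of (ρ, ρu e₁, E)(t) at
EVERY t < T. T is any time of contact-free small-BV existence: shock formation, propagation, decay,
shock–rarefaction interaction included (the card's thesis cut back from all t to contact-free
windows, see Kill criteria); for t < T* it is the conjunct on planar small-variation data. -/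
@[route_item "route-AtomisticToContinuum-PlanarWeakBV"]
def PlanarShockLimit : Prop :=
  let T1 : Type := UnitAddTorus (Fin 1); let pt : ℝ → T1 := fun r _ => ((r : ℝ) : UnitAddCircle); let e₀ := EuclideanSpace.single (0 : Fin 3) (1 : ℝ); let P := Literature.MathematicalPhysics.KineticTheory.hsPressure; let fx := Literature.MathematicalPhysics.KineticTheory.hsExcessFreeEnergy; let W := fun (a f φ : ℝ → T1 → ℝ) => (∫ t in Set.Ioi 0, ∫ y, (a t y * Literature.Analysis.FunctionSpaces.Torus.timeDeriv φ t y + f t y * Literature.Analysis.FunctionSpaces.Torus.partialDeriv (0 : Fin 1) (φ t) y)) + ∫ y, a 0 y * φ 0 y; let En := fun (ρ u θ : ℝ → T1 → ℝ) (t : ℝ) (y : T1) => ρ t y * (u t y ^ 2 / 2 + 3 / 2 * θ t y); let V := fun (ρ u θ : ℝ → T1 → ℝ) (t r : ℝ) => (ρ t (pt r), u t (pt r), θ t (pt r)); let J := fun (g : ℝ → ℝ) (r : ℝ) => Function.leftLim g r = Function.rightLim g r; let Fl := fun (σ : ℝ) => (N : ℕ) → Literature.Analysis.FluidPDE.HardSphereFlow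 (Literature.Analysis.FluidPDE.Torus.geometry (Fin 3)) (Literature.MathematicalPhysics.KineticTheory.hsDiameter σ N) (N + 1); ∃ η₀ > (0 : ℝ), ∀ A Θ U : T1 → ℝ, Continuous A → Continuous Θ → Continuous U → (∀ y, 0 < A y ∧ 0 < Θ y) → ∃ σ₀ > (0 : ℝ), ∀ σ, 0 < σ → σ < σ₀ → ∀ m M : ℝ, 0 < m → ∃ ε₀ > (0 : ℝ), ∀ T : ℝ, let S := fun ρ u θ : ℝ → T1 → ℝ => let q := fun (t : ℝ) (y : T1) => ρ t y * u t y; let H := fun (t : ℝ) (y : T1) => -(ρ t y * (3 / 2 * Real.log (θ t y) - Real.log (ρ t y) - fx (ρ t y * σ ^ 3))); (∀ f ∈ [ρ, u, θ], Measurable (Function.uncurry f)) ∧ (∀ t ∈ Set.Ico 0 T, Filter.Tendsto (fun s : ℝ => ∫ y, dist (ρ s y, u s y, θ s y) (ρ t y, u t y, θ t y)) (nhdsWithin t (Set.Ico 0 T)) (nhds 0)) ∧ ∀ φ : ℝ → T1 → ℝ, ContDiff ℝ (⊤ : ℕ∞) (Literature.Analysis.FunctionSpaces.Torus.stLift φ)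 → (∃ T' < T, ∀ t, T' ≤ t → ∀ y, φ t y = 0) → W ρ q φ = 0 ∧ W q (fun t y => q t y * u t y + P σ (ρ t y) (θ t y)) φ = 0 ∧ W (En ρ u θ) (fun t y => (En ρ u θ t y + P σ (ρ t y) (θ t y)) * u t y) φ = 0 ∧ ((∀ t y, 0 ≤ φ t y) → 0 ≤ W H (fun t y => H t y * u t y) φ); let B := fun (η m M : ℝ) (ρ u θ : ℝ → T1 → ℝ) => ∀ t ∈ Set.Ico 0 T, ∀ y, m ≤ ρ t y ∧ ρ t y ≤ M ∧ m ≤ θ t y ∧ θ t y ≤ M ∧ |u t y| ≤ M ∧ ρ t y * σ ^ 3 ≤ η; let Vr := fun (ε : ℝ) (ρ u θ : ℝ → T1 → ℝ) => ∀ t ∈ Set.Ico 0 T, eVariationOn (V ρ u θ t) (Set.Icc 0 1) ≤ ENNReal.ofReal ε; let C := fun ρ u : ℝ → T1 → ℝ => ∀ t ∈ Set.Ico 0 T, ∀ r : ℝ, J (fun r' => u t (pt r')) r → J (fun r' => ρ t (pt r')) r; ∀ ρ u θ : ℝ → T1 → ℝ, S ρ u θ → B η₀ m M ρ u θ → Vr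 ε₀ ρ u θ → C ρ u → ∀ Φ : Fl σ, let Lw := fun N : ℕ => Literature.MathematicalPhysics.KineticTheory.localGibbsLaw σ (fun x => A (fun _ => x 0)) (fun x => U (fun _ => x 0) • e₀) (fun x => Θ (fun _ => x 0)) N (Φ N); Literature.MathematicalPhysics.KineticTheory.TendstoHydroFieldsAt Lw Φ (fun s x => ρ s (fun _ => x 0)) (fun s x => u s (fun _ => x 0) • e₀) (fun s x => θ s (fun _ => x 0)) 0 → ∀ t ∈ Set.Ico 0 T, Literature.MathematicalPhysics.KineticTheory.TendstoHydroFieldsAt Lw Φ (fun s x => ρ s (fun _ => x 0)) (fun s x => u s (fun _ => x 0) • e₀) (fun s x => θ s (fun _ => x 0)) t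

/-- item stmt-AtomisticToContinuum-7705 · crux · rank 2 · closed · moot by None · by planner
why it might fail: Needs L∞/no-vacuum bounds and local equilibrium of slab fluxes off the O(Kn) shock layers with no entropy pin after T* (BoltzmannHypothesis barrier in flux form); the collisional-flux and velocity-tail estimates uniform through compressions that this requires may simply not exist.
sources: Spohn1991, OllaVaradhanYau1993, doi:10.1007/s002050100157, ChenKrupaVasseur2022, FritzToth2004, Fritz2011
[crux] ENTROPIC CLOSURE OF STRONG SUBSEQUENTIAL LIMITS (card crux 2 + the audit's no-vacuum flag).
Quantifiers as in the target (with the packing threshold η ≤ η₀ uniform); for every contact-free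
small-BV reference matched to the data by the t = 0 LLN, every flow family, every mesoscale ℓ_N → 0
with Nℓ_N → ∞ and every subsequence κ: IF the transversally averaged slab fields (density, momentum,
energy over slabs {x₁ ∈ [r, r+ℓ_N)}) converge along κ in probability in L¹((0,T) × 𝕋¹) to some
deterministic triple, THEN the limit is (the conserved triple of) a weak entropy solution (ρ′,u′,θ′)
of planar hs-Euler on [0,T) × 𝕋¹ in the sense (S) of the target, valued in the widened box (m/2, 2M)
with packing ≤ 2η, whose t = 0 slice is the reference's a.e. Microscopic content: local equilibrium
of slab fluxes off a set of vanishing measure (shock layers of width O(Kn) carry no macroscopic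
defect), the free second law, L∞/no-vacuum bounds; strong traces are the separate crux
PlanarTraceRegularity. [deps: PlanarMesoscaleRegularity, PlanarDeterminism] [difficulty:
open-problem] -/
@[route_item "route-AtomisticToContinuum-PlanarWeakBV"]
def PlanarEntropicClosure : Prop :=
  let T1 : Type := UnitAddTorus (Fin 1); let pt : ℝ → T1 := fun r _ => ((r : ℝ) : UnitAddCircle); let e₀ := EuclideanSpace.single (0 : Fin 3) (1 : ℝ); let P := Literature.MathematicalPhysics.KineticTheory.hsPressure; let fx := Literature.MathematicalPhysics.KineticTheory.hsExcessFreeEnergy; let W := fun (a f φ : ℝ → T1 → ℝ) => (∫ t in Set.Ioi 0, ∫ y, (a t y * Literature.Analysis.FunctionSpaces.Torus.timeDeriv φ t y + f t y * Literature.Analysis.FunctionSpaces.Torus.partialDeriv (0 : Fin 1) (φ t) y)) + ∫ y, a 0 y * φ 0 y; let En := fun (ρ u θ : ℝ → T1 → ℝ) (t : ℝ) (y : T1) => ρ t y * (u t y ^ 2 / 2 + 3 / 2 * θ t y); let V := fun (ρ u θ : ℝ → T1 → ℝ) (t r : ℝ) => (ρ t (pt r), u t (pt r), θ t (pt r)); let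 J := fun (g : ℝ → ℝ) (r : ℝ) => Function.leftLim g r = Function.rightLim g r; let Fl := fun (σ : ℝ) => (N : ℕ) → Literature.Analysis.FluidPDE.HardSphereFlow (Literature.Analysis.FluidPDE.Torus.geometry (Fin 3)) (Literature.MathematicalPhysics.KineticTheory.hsDiameter σ N) (N + 1); let D := fun (ℓ r : ℝ) => Set.indicator {x : UnitAddTorus (Fin 3) | ∃ y ∈ Set.Ico r (r + ℓ), ((y : ℝ) : UnitAddCircle) = x 0} (fun _ => ℓ⁻¹); let ST := fun (N : ℕ) (z : Literature.Analysis.FluidPDE.Config (N + 1) (Fin 3) (UnitAddTorus (Fin 3))) (χ : UnitAddTorus (Fin 3) → ℝ) => (Literature.MathematicalPhysics.KineticTheory.empiricalDensityField z χ, Literature.MathematicalPhysics.KineticTheory.empiricalMomentumField z χ, Literature.MathematicalPhysics.KineticTheory.empiricalEnergyField z χ); ∃ η₀ > (0 : ℝ), ∀ η, 0 < η → η ≤ η₀ → ∀ A Θ U : T1 → ℝ, Continuous A → Continuous Θ → Continuous U → (∀ y, 0 < A y ∧ 0 < Θ y) → ∃ σ₀ > (0 : ℝ), ∀ σ, 0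 < σ → σ < σ₀ → ∀ m M : ℝ, 0 < m → ∃ ε₀ > (0 : ℝ), ∀ T : ℝ, let S := fun ρ u θ : ℝ → T1 → ℝ => let q := fun (t : ℝ) (y : T1) => ρ t y * u t y; let H := fun (t : ℝ) (y : T1) => -(ρ t y * (3 / 2 * Real.log (θ t y) - Real.log (ρ t y) - fx (ρ t y * σ ^ 3))); (∀ f ∈ [ρ, u, θ], Measurable (Function.uncurry f)) ∧ (∀ t ∈ Set.Ico 0 T, Filter.Tendsto (fun s : ℝ => ∫ y, dist (ρ s y, u s y, θ s y) (ρ t y, u t y, θ t y)) (nhdsWithin t (Set.Ico 0 T)) (nhds 0)) ∧ ∀ φ : ℝ → T1 → ℝ, ContDiff ℝ (⊤ : ℕ∞) (Literature.Analysis.FunctionSpaces.Torus.stLift φ) → (∃ T' < T, ∀ t, T' ≤ t → ∀ y, φ t y = 0) → W ρ q φ = 0 ∧ W q (fun t y => q t y * u t y + P σ (ρ t y) (θ t y)) φ = 0 ∧ W (En ρ u θ) (fun t y => (En ρ u θ t y + P σ (ρ t y) (θ t y)) * u t y) φ = 0 ∧ ((∀ t y, 0 ≤ φ t y) → 0 ≤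 W H (fun t y => H t y * u t y) φ); let B := fun (η m M : ℝ) (ρ u θ : ℝ → T1 → ℝ) => ∀ t ∈ Set.Ico 0 T, ∀ y, m ≤ ρ t y ∧ ρ t y ≤ M ∧ m ≤ θ t y ∧ θ t y ≤ M ∧ |u t y| ≤ M ∧ ρ t y * σ ^ 3 ≤ η; let Vr := fun (ε : ℝ) (ρ u θ : ℝ → T1 → ℝ) => ∀ t ∈ Set.Ico 0 T, eVariationOn (V ρ u θ t) (Set.Icc 0 1) ≤ ENNReal.ofReal ε; let C := fun ρ u : ℝ → T1 → ℝ => ∀ t ∈ Set.Ico 0 T, ∀ r : ℝ, J (fun r' => u t (pt r')) r → J (fun r' => ρ t (pt r')) r; ∀ ρ u θ : ℝ → T1 → ℝ, S ρ u θ → B η m M ρ u θ → Vr ε₀ ρ u θ → C ρ u → ∀ Φ : Fl σ, let Lw := fun N : ℕ => Literature.MathematicalPhysics.KineticTheory.localGibbsLaw σ (fun x => A (fun _ => x 0)) (fun x => U (fun _ => x 0) • e₀) (fun x => Θ (fun _ => x 0)) N (Φ N); Literature.MathematicalPhysics.KineticTheory.TendstoHydroFieldsAt Lw Φ (fun s x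 => ρ s (fun _ => x 0)) (fun s x => u s (fun _ => x 0) • e₀) (fun s x => θ s (fun _ => x 0)) 0 → ∀ ℓ : ℕ → ℝ, Filter.Tendsto ℓ Filter.atTop (nhds 0) → Filter.Tendsto (fun N : ℕ => (N : ℝ) * ℓ N) Filter.atTop Filter.atTop → ∀ κ : ℕ → ℕ, StrictMono κ → let Cv := fun F : ℝ → ℝ → ℝ × EuclideanSpace ℝ (Fin 3) × ℝ => ∀ δ > (0 : ℝ), Filter.Tendsto (fun n : ℕ => Lw (κ n) {z | δ < ∫ t in Set.Ioo 0 T, ∫ r in Set.Icc (0 : ℝ) 1, dist (ST (κ n) ((Φ (κ n)).flow t z) (D (ℓ (κ n)) r)) (F t r)}) Filter.atTop (nhds 0); (∃ F, Cv F) → ∃ ρ' u' θ' : ℝ → T1 → ℝ, Cv (fun t r => (ρ' t (pt r), (ρ' t (pt r) * u' t (pt r)) • e₀, En ρ' u' θ' t (pt r))) ∧ S ρ' u' θ' ∧ B (2 * η) (m / 2) (2 * M) ρ' u' θ' ∧ ∀ᵐ y : T1, ρ' 0 y = ρ 0 y ∧ u' 0 y = u 0 y ∧ θ' 0 y = θ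 0 y

/-- item stmt-AtomisticToContinuum-7706 · crux · rank 3 · closed · moot by None · by planner
why it might fail: No known mechanism for 'particle compensated compactness': after T* nothing books mesoscale order (pre-shock large deviations do); persistent N-independent mesoscale structure (acoustic ringing, or RT debris at collision-born contacts) would break L1-equicontinuity of the expected slab profiles.
sources: FritzToth2004, Fritz2011, DiPernaMajda1987, doi:10.4007/annals.2005.161.223, Dafermos2005, Spohn1991
[crux] NO MESOSCALE RANDOMNESS, NO MESOSCALE OSCILLATION ('particle compensated compactness', card
crux 1). For continuous planar profiles, σ < σ₀, every flow family and every mesoscale ℓ_N → 0 with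
Nℓ_N → ∞: (a) at every t ≥ 0 the slab fields are L¹(𝕋¹)-close in probability to their expectations;
(b) for every horizon and ε′ there are h₀, N₀ such that for N ≥ N₀ and all t ≤ horizon the EXPECTED
slab profiles move by ≤ ε′ in L¹ under spatial shifts |h| ≤ h₀ (Kolmogorov–Riesz; shocks allowed,
persistent sub-grid oscillation not). All times, no window: slabs are exact transverse averages,
expected to survive even collision-born mixing zones. [difficulty: XL] -/
@[route_item "route-AtomisticToContinuum-PlanarWeakBV"]
def PlanarMesoscaleRegularity : Prop :=
  let T1 : Type := UnitAddTorus (Fin 1); let e₀ := EuclideanSpace.single (0 : Fin 3) (1 : ℝ); let Fl := fun (σ : ℝ) => (N : ℕ) → Literature.Analysis.FluidPDE.HardSphereFlow (Literature.Analysis.FluidPDE.Torus.geometry (Fin 3)) (Literature.MathematicalPhysics.KineticTheory.hsDiameter σ N) (N + 1); let D := fun (ℓ r : ℝ) => Set.indicator {x : UnitAddTorus (Fin 3) | ∃ y ∈ Set.Ico r (r + ℓ), ((y : ℝ) : UnitAddCircle) = x 0} (fun _ => ℓ⁻¹); let ST := fun (N : ℕ) (z : Literature.Analysis.FluidPDE.Config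 (N + 1) (Fin 3) (UnitAddTorus (Fin 3))) (χ : UnitAddTorus (Fin 3) → ℝ) => (Literature.MathematicalPhysics.KineticTheory.empiricalDensityField z χ, Literature.MathematicalPhysics.KineticTheory.empiricalMomentumField z χ, Literature.MathematicalPhysics.KineticTheory.empiricalEnergyField z χ); ∀ A Θ U : T1 → ℝ, Continuous A → Continuous Θ → Continuous U → (∀ y, 0 < A y ∧ 0 < Θ y) → ∃ σ₀ > (0 : ℝ), ∀ σ, 0 < σ → σ < σ₀ → ∀ Φ : Fl σ, let Lw := fun N : ℕ => Literature.MathematicalPhysics.KineticTheory.localGibbsLaw σ (fun x => A (fun _ => x 0)) (fun x => U (fun _ => x 0) • e₀) (fun x => Θ (fun _ => x 0)) N (Φ N); ∀ ℓ : ℕ → ℝ, Filter.Tendsto ℓ Filter.atTop (nhds 0) → Filter.Tendsto (fun N : ℕ => (N : ℝ) * ℓ N) Filter.atTop Filter.atTop → let Ex := fun (N : ℕ) (t r : ℝ) => (∫ z, Literature.MathematicalPhysics.KineticTheory.empiricalDensityField ((Φ N).flow t z) (D (ℓ N) r) ∂Lw N, ∫ z, Literature.MathematicalPhysics.KineticTheory.empiricalMomentumField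 ((Φ N).flow t z) (D (ℓ N) r) ∂Lw N, ∫ z, Literature.MathematicalPhysics.KineticTheory.empiricalEnergyField ((Φ N).flow t z) (D (ℓ N) r) ∂Lw N); (∀ t : ℝ, 0 ≤ t → ∀ δ > (0 : ℝ), Filter.Tendsto (fun N : ℕ => Lw N {z | δ < ∫ r in Set.Icc (0 : ℝ) 1, dist (ST N ((Φ N).flow t z) (D (ℓ N) r)) (Ex N t r)}) Filter.atTop (nhds 0)) ∧ (∀ T' ε' : ℝ, 0 < ε' → ∃ h₀ > (0 : ℝ), ∃ N₀ : ℕ, ∀ N, N₀ ≤ N → ∀ t ∈ Set.Icc 0 T', ∀ h : ℝ, |h| ≤ h₀ → ∫ r in Set.Icc (0 : ℝ) 1, dist (Ex N t (r + h)) (Ex N t r) ≤ ε')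

/-- item stmt-AtomisticToContinuum-7707 · crux · rank 4 · closed · moot by None · by planner
why it might fail: Macroscopic randomness may appear after T*: thermal seeds N^-1/2 amplified at an N-divergent rate (KH at slip surfaces: N^1/6, zero-horizon card); planar hs-shocks are Majda-stable and planar contacts carry no shear, but RT at accelerated contacts (rate eps^2 N^1/12) is only argued to self-average.
sources: doi:10.1090/memo/0275, Majda1984, BandakEtAl2024, KadauEtAl2004, Spohn1991, OllaVaradhanYau1993
[crux] DETERMINISM OF THE MACROSTATE AT ALL TIMES (the audit's unlisted crux 'PlanarityPersistence',
typed over the conjunct's vocabulary). For continuous planar profiles, σ < σ₀, every flow family and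
every continuous χ on 𝕋³ there are deterministic centre paths c_N(t) ∈ ℝ × ℝ³ × ℝ with (a) at EVERY
t ≥ 0 the χ-tested empirical density/momentum/energy fields concentrate in probability around c_N(t)
(LLN without identification, through shocks and collisions), (b) {c_N} equicontinuous on bounded
time intervals uniformly in N (where collisional momentum/energy transfer must be tight). With
PlanarLawInvariance it pins limit points to planar fields — the card's symmetry remark (S) that
removes multi-d wild solutions for deterministic limits. [difficulty: XL] -/
@[route_item "route-AtomisticToContinuum-PlanarWeakBV"]
def PlanarDeterminism : Prop :=
  let T1 : Type := UnitAddTorus (Fin 1); let e₀ := EuclideanSpace.single (0 : Fin 3) (1 : ℝ); let Fl := fun (σ : ℝ) => (N : ℕ) → Literature.Analysis.FluidPDE.HardSphereFlow (Literature.Analysis.FluidPDE.Torus.geometry (Fin 3)) (Literature.MathematicalPhysics.KineticTheory.hsDiameter σ N) (N + 1); let ST := fun (N : ℕ) (z : Literature.Analysis.FluidPDE.Config (N + 1) (Fin 3) (UnitAddTorus (Fin 3))) (χ : UnitAddTorus (Fin 3) → ℝ) => (Literature.MathematicalPhysics.KineticTheory.empiricalDensityField z χ, Literature.MathematicalPhysics.KineticTheory.empiricalMomentumField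 z χ, Literature.MathematicalPhysics.KineticTheory.empiricalEnergyField z χ); ∀ A Θ U : T1 → ℝ, Continuous A → Continuous Θ → Continuous U → (∀ y, 0 < A y ∧ 0 < Θ y) → ∃ σ₀ > (0 : ℝ), ∀ σ, 0 < σ → σ < σ₀ → ∀ Φ : Fl σ, let Lw := fun N : ℕ => Literature.MathematicalPhysics.KineticTheory.localGibbsLaw σ (fun x => A (fun _ => x 0)) (fun x => U (fun _ => x 0) • e₀) (fun x => Θ (fun _ => x 0)) N (Φ N); ∀ χ : UnitAddTorus (Fin 3) → ℝ, Continuous χ → ∃ c : ℕ → ℝ → ℝ × EuclideanSpace ℝ (Fin 3) × ℝ, (∀ t : ℝ, 0 ≤ t → ∀ δ > (0 : ℝ), Filter.Tendsto (fun N : ℕ => Lw N {z | δ < dist (ST N ((Φ N).flow t z) χ) (c N t)}) Filter.atTop (nhds 0)) ∧ (∀ T' ε' : ℝ, 0 < ε' → ∃ τ > (0 : ℝ), ∃ N₀ : ℕ, ∀ N, N₀ ≤ N → ∀ t ∈ Set.Icc 0 T', ∀ t' ∈ Set.Icc 0 T', |t - t'| ≤ τ → dist (c N t) (c N t') ≤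 ε')

/-- item stmt-AtomisticToContinuum-7708 · crux · rank 5 · closed · moot by None · by planner
why it might fail: Strong traces are theorems for scalar laws (Vasseur 2001, kinetic formulation) and automatic for BV functions; for L∞ entropy solutions of systems they are open (CKV 2022: mostly open) and a particle limit need not be BV; even the ess-lim form may fail where wave interactions accumulate.
sources: doi:10.1007/s002050100157, ChenKrupaVasseur2022, LegerVasseur2011, doi:10.1142/s0219891619500061, Dafermos2005
[crux] STRONG TRACES OF STRONG LIMITS (audit flag (2) as its own crux: the regularity half of the
weak–BV competitor class). For continuous planar profiles, σ < σ₀, every box (η,m,M), horizon T,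
flow family, ℓ_N, κ: a triple (ρ′,u′,θ′) whose conserved fields are the L¹((0,T)×𝕋¹)-in-probability
limit of the slab fields along κ and which is a weak entropy solution (S) valued in the box has
strong traces in Vasseur's ess-lim L¹ form along every Lipschitz curve, from both sides, on every
[0,T′], T′ < T. No window restriction: a limit that is BV in x at a.e. t has them; the content is
that particle limits are at least that regular. [deps: PlanarEntropicClosure] [difficulty:
open-problem] -/
@[route_item "route-AtomisticToContinuum-PlanarWeakBV"]
def PlanarTraceRegularity : Prop :=
  let T1 : Type := UnitAddTorus (Fin 1); let pt : ℝ → T1 := fun r _ => ((r : ℝ) : UnitAddCircle); let e₀ := EuclideanSpace.single (0 : Fin 3) (1 : ℝ); let P := Literature.MathematicalPhysics.KineticTheory.hsPressure; let fx := Literature.MathematicalPhysics.KineticTheory.hsExcessFreeEnergy; let W := fun (a f φ : ℝ → T1 → ℝ) => (∫ t in Set.Ioi 0, ∫ y, (a t y * Literature.Analysis.FunctionSpaces.Torus.timeDeriv φ t y + f t y * Literature.Analysis.FunctionSpaces.Torus.partialDeriv (0 : Fin 1) (φ t) y)) + ∫ y, a 0 y * φ 0 y; let En := fun (ρ u θ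 : ℝ → T1 → ℝ) (t : ℝ) (y : T1) => ρ t y * (u t y ^ 2 / 2 + 3 / 2 * θ t y); let V := fun (ρ u θ : ℝ → T1 → ℝ) (t r : ℝ) => (ρ t (pt r), u t (pt r), θ t (pt r)); let Fl := fun (σ : ℝ) => (N : ℕ) → Literature.Analysis.FluidPDE.HardSphereFlow (Literature.Analysis.FluidPDE.Torus.geometry (Fin 3)) (Literature.MathematicalPhysics.KineticTheory.hsDiameter σ N) (N + 1); let D := fun (ℓ r : ℝ) => Set.indicator {x : UnitAddTorus (Fin 3) | ∃ y ∈ Set.Ico r (r + ℓ), ((y : ℝ) : UnitAddCircle) = x 0} (fun _ => ℓ⁻¹); let ST := fun (N : ℕ) (z : Literature.Analysis.FluidPDE.Config (N + 1) (Fin 3) (UnitAddTorus (Fin 3))) (χ : UnitAddTorus (Fin 3) → ℝ) => (Literature.MathematicalPhysics.KineticTheory.empiricalDensityField z χ, Literature.MathematicalPhysics.KineticTheory.empiricalMomentumField z χ, Literature.MathematicalPhysics.KineticTheory.empiricalEnergyField z χ); ∀ A Θ U : T1 → ℝ, Continuous A → Continuous Θ → Continuous U → (∀ y, 0 < A y ∧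 0 < Θ y) → ∃ σ₀ > (0 : ℝ), ∀ σ, 0 < σ → σ < σ₀ → ∀ η m M T : ℝ, let S := fun ρ u θ : ℝ → T1 → ℝ => let q := fun (t : ℝ) (y : T1) => ρ t y * u t y; let H := fun (t : ℝ) (y : T1) => -(ρ t y * (3 / 2 * Real.log (θ t y) - Real.log (ρ t y) - fx (ρ t y * σ ^ 3))); (∀ f ∈ [ρ, u, θ], Measurable (Function.uncurry f)) ∧ (∀ t ∈ Set.Ico 0 T, Filter.Tendsto (fun s : ℝ => ∫ y, dist (ρ s y, u s y, θ s y) (ρ t y, u t y, θ t y)) (nhdsWithin t (Set.Ico 0 T)) (nhds 0)) ∧ ∀ φ : ℝ → T1 → ℝ, ContDiff ℝ (⊤ : ℕ∞) (Literature.Analysis.FunctionSpaces.Torus.stLift φ) → (∃ T' < T, ∀ t, T' ≤ t → ∀ y, φ t y = 0) → W ρ q φ = 0 ∧ W q (fun t y => q t y * u t y + P σ (ρ t y) (θ t y)) φ = 0 ∧ W (En ρ u θ) (fun t y => (En ρ u θ t y + P σ (ρ t y) (θ t y)) * u t y) φ = 0 ∧ ((∀ t y, 0 ≤ φ t y) →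 0 ≤ W H (fun t y => H t y * u t y) φ); let B := fun (η m M : ℝ) (ρ u θ : ℝ → T1 → ℝ) => ∀ t ∈ Set.Ico 0 T, ∀ y, m ≤ ρ t y ∧ ρ t y ≤ M ∧ m ≤ θ t y ∧ θ t y ≤ M ∧ |u t y| ≤ M ∧ ρ t y * σ ^ 3 ≤ η; let Q := fun ρ u θ : ℝ → T1 → ℝ => ∀ X : ℝ → ℝ, (∃ K : NNReal, LipschitzWith K X) → ∃ Ul Ur : ℝ → ℝ × ℝ × ℝ, ∀ T' < T, ∀ ε > (0 : ℝ), ∃ δ > (0 : ℝ), (∀ᵐ y ∂(MeasureTheory.volume.restrict (Set.Ioo 0 δ)), (∫⁻ t in Set.Icc 0 T', ENNReal.ofReal (dist (V ρ u θ t (X t + y)) (Ur t))) ≤ ENNReal.ofReal ε) ∧ (∀ᵐ y ∂(MeasureTheory.volume.restrict (Set.Ioo 0 δ)), (∫⁻ t in Set.Icc 0 T', ENNReal.ofReal (dist (V ρ u θ t (X t - y)) (Ul t))) ≤ ENNReal.ofReal ε); ∀ Φ : Fl σ, let Lw := fun N : ℕ => Literature.MathematicalPhysics.KineticTheory.localGibbsLaw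 σ (fun x => A (fun _ => x 0)) (fun x => U (fun _ => x 0) • e₀) (fun x => Θ (fun _ => x 0)) N (Φ N); ∀ ℓ : ℕ → ℝ, Filter.Tendsto ℓ Filter.atTop (nhds 0) → Filter.Tendsto (fun N : ℕ => (N : ℝ) * ℓ N) Filter.atTop Filter.atTop → ∀ κ : ℕ → ℕ, StrictMono κ → let Cv := fun F : ℝ → ℝ → ℝ × EuclideanSpace ℝ (Fin 3) × ℝ => ∀ δ > (0 : ℝ), Filter.Tendsto (fun n : ℕ => Lw (κ n) {z | δ < ∫ t in Set.Ioo 0 T, ∫ r in Set.Icc (0 : ℝ) 1, dist (ST (κ n) ((Φ (κ n)).flow t z) (D (ℓ (κ n)) r)) (F t r)}) Filter.atTop (nhds 0); ∀ ρ' u' θ' : ℝ → T1 → ℝ, Cv (fun t r => (ρ' t (pt r), (ρ' t (pt r) * u' t (pt r)) • e₀, En ρ' u' θ' t (pt r))) → S ρ' u' θ' → B η m M ρ' u' θ' → Q ρ' u' θ'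

/-- item stmt-AtomisticToContinuum-7709 · crux · rank 6 · closed · moot by None · by planner
why it might fail: ChenVasseur2024 is printed for the ideal gas on R with the CKV competitor class (L∞, one entropy, sup-form traces); for p = rho theta Z(rho sigma^3) the shock a-contraction criteria must be re-verified (GNL and entropy convexity hold at small packing); ess-lim traces and the torus are adaptations.
sources: ChenVasseur2024, ChenKrupaVasseur2022, KangVasseur2020, Vasseur2026, doi:10.1142/s0219891619500061, LegerVasseur2011
[crux] WEAK–BV UNIQUENESS FOR THE HARD-SPHERE LAW ON THE 1-TORUS (card crux 3; PDE). ∃ η₀ > 0 ∀ σ >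
0 ∀ box (m,M) ∃ ε₀ > 0: on any [0,T) × 𝕋¹ a weak entropy solution (S) valued in the box with packing
≤ η₀ and variation ≤ ε₀ per period at every t is UNIQUE among weak entropy solutions (S) in the same
box having ess-lim strong traces and the same t = 0 slice a.e. ChenVasseur2024 (nonisentropic ideal
gas: small-BV solutions unique among a large family of weak solutions; weighted relative entropy
with shifts + modified front tracking, CKV2022 Thm 1.3 architecture) adapted to p = ρθZ(ρσ³), e =
3θ/2 (strict hyperbolicity, genuinely nonlinear acoustic fields, strictly convex −ρs at packing <
η₀: HsEulerGNL, HsEntropyConvex), localised to the torus by finite propagation speed. [deps: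
HsEulerGNL, HsEntropyConvex] [difficulty: L] -/
@[route_item "route-AtomisticToContinuum-PlanarWeakBV"]
def WeakBVUniquenessHS : Prop :=
  let T1 : Type := UnitAddTorus (Fin 1); let pt : ℝ → T1 := fun r _ => ((r : ℝ) : UnitAddCircle); let P := Literature.MathematicalPhysics.KineticTheory.hsPressure; let fx := Literature.MathematicalPhysics.KineticTheory.hsExcessFreeEnergy; let W := fun (a f φ : ℝ → T1 → ℝ) => (∫ t in Set.Ioi 0, ∫ y, (a t y * Literature.Analysis.FunctionSpaces.Torus.timeDeriv φ t y + f t y * Literature.Analysis.FunctionSpaces.Torus.partialDeriv (0 : Fin 1) (φ t) y)) + ∫ y, a 0 y * φ 0 y; let En := fun (ρ u θ : ℝ → T1 → ℝ) (t : ℝ) (y : T1) => ρ t y * (u t y ^ 2 / 2 + 3 / 2 * θ t y); let V := fun (ρ u θ : ℝ → T1 → ℝ) (t r : ℝ) => (ρ t (pt r), u t (pt r), θ t (pt r)); ∃ η₀ > (0 : ℝ), ∀ σ > (0 : ℝ), ∀ m M : ℝ, 0 < m → ∃ ε₀ > (0 : ℝ), ∀ T : ℝ, let S := fun ρ u θ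 : ℝ → T1 → ℝ => let q := fun (t : ℝ) (y : T1) => ρ t y * u t y; let H := fun (t : ℝ) (y : T1) => -(ρ t y * (3 / 2 * Real.log (θ t y) - Real.log (ρ t y) - fx (ρ t y * σ ^ 3))); (∀ f ∈ [ρ, u, θ], Measurable (Function.uncurry f)) ∧ (∀ t ∈ Set.Ico 0 T, Filter.Tendsto (fun s : ℝ => ∫ y, dist (ρ s y, u s y, θ s y) (ρ t y, u t y, θ t y)) (nhdsWithin t (Set.Ico 0 T)) (nhds 0)) ∧ ∀ φ : ℝ → T1 → ℝ, ContDiff ℝ (⊤ : ℕ∞) (Literature.Analysis.FunctionSpaces.Torus.stLift φ) → (∃ T' < T, ∀ t, T' ≤ t → ∀ y, φ t y = 0) → W ρ q φ = 0 ∧ W q (fun t y => q t y * u t y + P σ (ρ t y) (θ t y)) φ = 0 ∧ W (En ρ u θ) (fun t y => (En ρ u θ t y + P σ (ρ t y) (θ t y)) * u t y) φ = 0 ∧ ((∀ t y, 0 ≤ φ t y) → 0 ≤ W H (fun t y => H t y * u t y) φ); let B := fun (η m M : ℝ) (ρ u θ : ℝ → T1 → ℝ) => ∀ t ∈ Set.Ico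 0 T, ∀ y, m ≤ ρ t y ∧ ρ t y ≤ M ∧ m ≤ θ t y ∧ θ t y ≤ M ∧ |u t y| ≤ M ∧ ρ t y * σ ^ 3 ≤ η; let Vr := fun (ε : ℝ) (ρ u θ : ℝ → T1 → ℝ) => ∀ t ∈ Set.Ico 0 T, eVariationOn (V ρ u θ t) (Set.Icc 0 1) ≤ ENNReal.ofReal ε; let Q := fun ρ u θ : ℝ → T1 → ℝ => ∀ X : ℝ → ℝ, (∃ K : NNReal, LipschitzWith K X) → ∃ Ul Ur : ℝ → ℝ × ℝ × ℝ, ∀ T' < T, ∀ ε > (0 : ℝ), ∃ δ > (0 : ℝ), (∀ᵐ y ∂(MeasureTheory.volume.restrict (Set.Ioo 0 δ)), (∫⁻ t in Set.Icc 0 T', ENNReal.ofReal (dist (V ρ u θ t (X t + y)) (Ur t))) ≤ ENNReal.ofReal ε) ∧ (∀ᵐ y ∂(MeasureTheory.volume.restrict (Set.Ioo 0 δ)), (∫⁻ t in Set.Icc 0 T', ENNReal.ofReal (dist (V ρ u θ t (X t - y)) (Ul t))) ≤ ENNReal.ofReal ε); ∀ ρ u θ : ℝ → T1 → ℝ, S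 ρ u θ → B η₀ m M ρ u θ → Vr ε₀ ρ u θ → ∀ ρ' u' θ' : ℝ → T1 → ℝ, S ρ' u' θ' → B η₀ m M ρ' u' θ' → Q ρ' u' θ' → (∀ᵐ y : T1, ρ' 0 y = ρ 0 y ∧ u' 0 y = u 0 y ∧ θ' 0 y = θ 0 y) → ∀ t ∈ Set.Ico 0 T, ∀ᵐ y : T1, ρ' t y = ρ t y ∧ u' t y = u t y ∧ θ' t y = θ t y

/-- item stmt-AtomisticToContinuum-7710 · support · rank 9 · closed · moot by None · by planner
sources: Spohn1991, Alexander1975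
[support] SYMMETRY OF THE LAW (card support (S)). For every σ, N, flow Φ, time t: profiles invariant
under a translation of 𝕋³ ⟹ the time-t law (push-forward of the local Gibbs law by Φ_t) is invariant
under translating all positions; profiles invariant under reflection of the j-th coordinate
(velocity reflected) ⟹ the time-t law is invariant under reflecting the j-th position and velocity
coordinates of all particles. Planar profiles: all transverse translations and both transverse
reflections (expected transverse momenta vanish, expected fields are x₂,x₃-independent). Proof:
isometry invariance of canonicalDensity/hardSphereDomain, a.e. uniqueness of trajectories
(IsHardSphereTrajectory.unique), Liouville. [difficulty: provable-now] -/
@[route_item "route-AtomisticToContinuum-PlanarWeakBV"]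
def PlanarLawInvariance : Prop :=
  ∀ (σ : ℝ) (a₀ θ₀ : UnitAddTorus (Fin 3) → ℝ) (u₀ : UnitAddTorus (Fin 3) → EuclideanSpace ℝ (Fin 3)) (N : ℕ) (Φ : Literature.Analysis.FluidPDE.HardSphereFlow (Literature.Analysis.FluidPDE.Torus.geometry (Fin 3)) (Literature.MathematicalPhysics.KineticTheory.hsDiameter σ N) (N + 1)) (t : ℝ), let μ := (MeasureTheory.Measure.map (Φ.flow t) (Literature.MathematicalPhysics.KineticTheory.localGibbsLaw σ a₀ u₀ θ₀ N Φ)); (∀ v : UnitAddTorus (Fin 3), (∀ x, a₀ (x + v) = a₀ x ∧ θ₀ (x + v) = θ₀ x ∧ u₀ (x + v) = u₀ x) → MeasureTheory.Measure.map (fun z : Literature.Analysis.FluidPDE.Config (N + 1) (Fin 3) (UnitAddTorus (Fin 3)) => fun i => ((z i).1 + v, (z i).2)) μ = μ) ∧ (∀ j : Fin 3, (∀ x : UnitAddTorus (Fin 3), a₀ (fun k => if k = j then -(x k) else x k) = a₀ x ∧ θ₀ (fun k => if k = j then -(x k) else x k) = θ₀ x ∧ u₀ (fun k => if k = j then -(x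 k) else x k) = (WithLp.toLp 2 (fun k => if k = j then -((u₀ x) k) else (u₀ x) k))) → MeasureTheory.Measure.map (fun z : Literature.Analysis.FluidPDE.Config (N + 1) (Fin 3) (UnitAddTorus (Fin 3)) => fun i => ((fun k => if k = j then -(((z i).1) k) else ((z i).1) k), (WithLp.toLp 2 (fun k => if k = j then -(((z i).2) k) else ((z i).2) k)))) μ = μ)

/-- item stmt-AtomisticToContinuum-7711 · support · rank 9 · closed · moot by None · by planner
sources: Ruelle1969, LebowitzPenrose1964, Dafermos2005
[support] STRUCTURE OF PLANAR hs-EULER AT LOW PACKING (audit flag (4)). ∃ η₀ > 0: Z =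
hsCompressibility is C² on [0,η₀] and for η ≤ η₀: Φ := Z + ηZ′ + (2/3)Z² > 0 (strict hyperbolicity,
c² = θΦ) and Ψ := (2 + (2/3)Z)Φ + ηΦ′ > 0 (genuine nonlinearity of both acoustic fields: ∂²p/∂τ²|ₛ =
θτ⁻³Ψ for p = θZ(σ³/τ)/τ, e = 3θ/2). At η = 0: Φ = 5/3, Ψ = 40/9 = γ(γ+1), γ = 5/3 (norm_num in the
planner's Check.lean); C² of Z near 0 is the virial analyticity (HsEosLowDensity, stmt 0768).
[difficulty: M] -/
@[route_item "route-AtomisticToContinuum-PlanarWeakBV"]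
def HsEulerGNL : Prop :=
  ∃ η₀ > (0 : ℝ), let Z := Literature.MathematicalPhysics.KineticTheory.hsCompressibility; let Φ := fun η : ℝ => Z η + η * deriv Z η + 2 / 3 * Z η ^ 2; ContDiffOn ℝ 2 Z (Set.Icc 0 η₀) ∧ ∀ η ∈ Set.Icc (0 : ℝ) η₀, 0 < Φ η ∧ 0 < (2 + 2 / 3 * Z η) * Φ η + η * deriv Φ η

/-- item stmt-AtomisticToContinuum-7712 · support · rank 9 · closed · moot by None · by planner
sources: Dafermos2005, BrezinaFeireisl2018, Ruelle1969
[support] THERMODYNAMIC STABILITY (shared: identical to stmt-AtomisticToContinuum-0817 of route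
DissipativeWeakStrong, re-wanted as the single strictly convex entropy of the a-contraction theory):
strict convexity of U = (ρ,m,E) ↦ −ρ(3/2 log θ(U) − log ρ − f_ex(ρσ³)) on {ρ > 0, ρσ³ < η₀, |m|² <
2ρE}. [difficulty: M] -/
@[route_item "route-AtomisticToContinuum-PlanarWeakBV"]
def HsEntropyConvex : Prop :=
  ∃ η₀ : ℝ, 0 < η₀ ∧ ∀ σ : ℝ, 0 < σ → StrictConvexOn ℝ {U : ℝ × Literature.MathematicalPhysics.KineticTheory.V3 × ℝ | 0 < U.1 ∧ U.1 * σ ^ 3 < η₀ ∧ ‖U.2.1‖ ^ 2 < 2 * U.1 * U.2.2} (fun U : ℝ × Literature.MathematicalPhysics.KineticTheory.V3 × ℝ => -(U.1 * (3 / 2 * Real.log (2 / 3 * (U.2.2 / U.1 - ‖U.2.1‖ ^ 2 / (2 * U.1 ^ 2))) - Real.log U.1 - Literature.MathematicalPhysics.KineticTheory.hsExcessFreeEnergy (U.1 * σ ^ 3))))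

/-- item stmt-AtomisticToContinuum-7713 · support · rank 9 · closed · moot by None · by planner
sources: doi:10.1002/cpa.3160180408, Bressan2024, QuXin2014, Dafermos2005, LiuYang1999
[support] NON-VACUITY OF THE TARGET'S REFERENCE: ∃ η₀ > 0 ∀ σ > 0, box, ε₀ > 0, T ∃ ε₁ > 0: every
measurable datum on 𝕋¹ of variation ≤ ε₁ in the half-box (2m ≤ ρ₀,θ₀ ≤ M/2, |u₀| ≤ M/2, packing ≤
η₀/2) launches a weak entropy solution (S) on [0,T) × 𝕋¹ with that initial slice, in the box, of
variation ≤ ε₀ at every t < T. Glimm/front tracking on ℝ + finite propagation speed for periodic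
data (per-period variation ≲ ε₀/(1+T)); QuXin2014: long-time periodic existence for the
nonisentropic ideal gas. Contact-freeness is not asserted (it holds before the first shock–shock
collision, e.g. for single-hump simple-wave data on all of [0,T)). [deps: HsEulerGNL,
HsEntropyConvex] [difficulty: XL] -/
@[route_item "route-AtomisticToContinuum-PlanarWeakBV"]
def SmallBVExistenceT1 : Prop :=
  let T1 : Type := UnitAddTorus (Fin 1); let pt : ℝ → T1 := fun r _ => ((r : ℝ) : UnitAddCircle); let P := Literature.MathematicalPhysics.KineticTheory.hsPressure; let fx := Literature.MathematicalPhysics.KineticTheory.hsExcessFreeEnergy; let W := fun (a f φ : ℝ → T1 → ℝ) => (∫ t in Set.Ioi 0, ∫ y, (a t y * Literature.Analysis.FunctionSpaces.Torus.timeDeriv φ t y + f t y * Literature.Analysis.FunctionSpaces.Torus.partialDeriv (0 : Fin 1) (φ t) y)) + ∫ y, a 0 y * φ 0 y; let En := fun (ρ u θ : ℝ → T1 → ℝ) (t : ℝ) (y : T1) => ρ t y * (u t y ^ 2 / 2 + 3 / 2 * θ t y); let V := fun (ρ u θ : ℝ → T1 → ℝ) (t r : ℝ) => (ρ t (pt r),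 u t (pt r), θ t (pt r)); ∃ η₀ > (0 : ℝ), ∀ σ > (0 : ℝ), ∀ m M : ℝ, 0 < m → ∀ ε₀ > (0 : ℝ), ∀ T : ℝ, ∃ ε₁ > (0 : ℝ), let S := fun ρ u θ : ℝ → T1 → ℝ => let q := fun (t : ℝ) (y : T1) => ρ t y * u t y; let H := fun (t : ℝ) (y : T1) => -(ρ t y * (3 / 2 * Real.log (θ t y) - Real.log (ρ t y) - fx (ρ t y * σ ^ 3))); (∀ f ∈ [ρ, u, θ], Measurable (Function.uncurry f)) ∧ (∀ t ∈ Set.Ico 0 T, Filter.Tendsto (fun s : ℝ => ∫ y, dist (ρ s y, u s y, θ s y) (ρ t y, u t y, θ t y)) (nhdsWithin t (Set.Ico 0 T)) (nhds 0)) ∧ ∀ φ : ℝ → T1 → ℝ, ContDiff ℝ (⊤ : ℕ∞) (Literature.Analysis.FunctionSpaces.Torus.stLift φ) → (∃ T' < T, ∀ t, T' ≤ t → ∀ y, φ t y = 0) → W ρ q φ = 0 ∧ W q (fun t y => q t y * u t y + P σ (ρ t y) (θ t y)) φ = 0 ∧ W (En ρ u θ) (fun t y => (En ρ u θ t y + P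 σ (ρ t y) (θ t y)) * u t y) φ = 0 ∧ ((∀ t y, 0 ≤ φ t y) → 0 ≤ W H (fun t y => H t y * u t y) φ); let B := fun (η m M : ℝ) (ρ u θ : ℝ → T1 → ℝ) => ∀ t ∈ Set.Ico 0 T, ∀ y, m ≤ ρ t y ∧ ρ t y ≤ M ∧ m ≤ θ t y ∧ θ t y ≤ M ∧ |u t y| ≤ M ∧ ρ t y * σ ^ 3 ≤ η; let Vr := fun (ε : ℝ) (ρ u θ : ℝ → T1 → ℝ) => ∀ t ∈ Set.Ico 0 T, eVariationOn (V ρ u θ t) (Set.Icc 0 1) ≤ ENNReal.ofReal ε; ∀ ρ₀ u₀ θ₀ : T1 → ℝ, (∀ f ∈ [ρ₀, u₀, θ₀], Measurable f) → eVariationOn (fun r : ℝ => (ρ₀ (pt r), u₀ (pt r), θ₀ (pt r))) (Set.Icc 0 1) ≤ ENNReal.ofReal ε₁ → (∀ y, 2 * m ≤ ρ₀ y ∧ ρ₀ y ≤ M / 2 ∧ 2 * m ≤ θ₀ y ∧ θ₀ y ≤ M / 2 ∧ |u₀ y| ≤ M / 2 ∧ ρ₀ y * σ ^ 3 ≤ η₀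 / 2) → ∃ ρ u θ : ℝ → T1 → ℝ, ρ 0 = ρ₀ ∧ u 0 = u₀ ∧ θ 0 = θ₀ ∧ S ρ u θ ∧ B η₀ m M ρ u θ ∧ Vr ε₀ ρ u θ

/-- item stmt-AtomisticToContinuum-7714 · assembly · rank 1 · closed · moot by None · by planner
sources: ChenKrupaVasseur2022, Spohn1991, Dafermos2005
[assembly] PlanarDeterminism → PlanarMesoscaleRegularity → PlanarEntropicClosure →
PlanarTraceRegularity → WeakBVUniquenessHS → PlanarLawInvariance → PlanarShockLimit. -/
@[route_item "route-AtomisticToContinuum-PlanarWeakBV"]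
def Assembly : Prop :=
  PlanarDeterminism → PlanarMesoscaleRegularity → PlanarEntropicClosure → PlanarTraceRegularity → WeakBVUniquenessHS → PlanarLawInvariance → PlanarShockLimit

end Summit.AtomisticToContinuum.HydrodynamicLimit.Theses.PlanarWeakBV
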